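import Summits.Ventures.CertifiedArithmetic.Expansions.WeakExpansion
import Literature.ComputerArithmetic.Shewchuk1997.ScaleExpansion

/-!
# Weakly nonoverlapping expansions, part 2 (§2–§4): tail bounds and the strengthened invariant

HONEST FRAMING (ENGINES group, unit `eng-quad-4`, kernels lane of the `certquad` engine — shared
numerical engines serving client cells; rigour lives in the verifiers; every published number
belongs to a client cell's ledger, not to the engines group): NEW WORK of the lane's Lean line, not a
published result, hence under `Summits/Ventures/` with no citation tag; nothing here is cited anywhere
as a literature fact.  Overview, statements in words, evidence and the proof outline (§1–§11):
module docstring of `WeakExpansion.lean` in this directory.  This file introduces no definitions.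

CONTENTS.  §2 the tail bound `abs_sum_lt_of_isWeakExpansion_append'` (what lies weakly below an odd
multiple of `2^v` sums to `< ¾·2^v`); §3 the top-component lemma `abs_top_of_isWeakExpansion`; §4 the
opening moves of a loop step from a state of the strengthened invariant `FesInvW` (defined in part 1),
`FesInvW.prelude`.
-/

namespace Summit.Ventures.CertifiedArithmetic.Expansions

open Literature.ComputerArithmetic.JeannerodRump2018
open Literature.ComputerArithmetic.BoldoJeannerodMelquiondMuller2023 hiding twoSum twoSum_fst isFloat_twoSum
open Literature.ComputerArithmetic.Shewchuk1997

variable {p : ℕ} {emin : ℤ} {fl : ℚ → ℚ}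

/-! ### §2  The tail bound: what lies weakly below an odd multiple of `2^v` sums to `< ¾·2^v` -/

/-- In a weakly nonoverlapping expansion of floats, the components below a component `x = M·2^v`
(`M` odd) sum to less than `(3/4)·2^v` in magnitude: either the largest of them is nonadjacent to
`x` (then all of them are `< 2^(v−1)` and so is their sum), or it is the one-bit number `±2^(v−1)`,
and then the triple condition puts everything else 2-below it, summing to `< 2^(v−2)`. -/
theorem abs_sum_lt_of_isWeakExpansion_append :
    ∀ (n : ℕ) (l : List ℚ) (x : ℚ), l.length ≤ n → (∀ y ∈ l, IsFloat p emin y) →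
      IsWeakExpansion (l ++ [x]) → ∀ {M v : ℤ}, Odd M → x = (M : ℚ) * (2 : ℚ) ^ v →
      |l.sum| < 3 / 4 * (2 : ℚ) ^ v := by
  intro n
  induction n with
  | zero =>
    intro l x hn _ _ M v _ _
    rw [List.eq_nil_of_length_eq_zero (Nat.le_zero.mp hn), List.sum_nil, abs_zero]
    exact mul_pos (by norm_num) (zpow_pos (by norm_num) _)
  | succ n ih =>
    intro l x hn hlF hw M v hM hx
    have h2 : (0 : ℚ) < 2 := by norm_num
    have h2v : (0 : ℚ) < (2 : ℚ) ^ v := zpow_pos h2 _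
    have hv1 : (2 : ℚ) ^ (v - 1) = (2 : ℚ) ^ v / 2 := by
      rw [zpow_sub_one₀ (by norm_num : (2:ℚ) ≠ 0)]; ring
    have hv2 : (2 : ℚ) ^ (v - 2) = (2 : ℚ) ^ v / 4 := by
      rw [show v - 2 = v - 1 - 1 by ring, zpow_sub_one₀ (by norm_num : (2:ℚ) ≠ 0),
        zpow_sub_one₀ (by norm_num : (2:ℚ) ≠ 0)]; ring
    rcases l.eq_nil_or_concat with rfl | ⟨l', y, rfl⟩
    · rw [List.sum_nil, abs_zero]; exact mul_pos (by norm_num) h2v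
    simp only [List.concat_eq_append] at hn hlF hw ⊢
    have hn' : l'.length ≤ n := by
      rw [List.length_append, List.length_singleton] at hn; omega
    have hl'F : ∀ z ∈ l', IsFloat p emin z := fun z hz => hlF z (List.mem_append_left _ hz)
    by_cases hy0 : y = 0
    · have hsub : (l' ++ [x]).Sublist (l' ++ [y] ++ [x]) :=
        (List.sublist_append_left l' [y]).append (List.Sublist.refl _)
      have := ih l' x hn' hl'F (hw.sublist hsub) hM hx
      rwa [List.sum_append, List.sum_singleton, hy0, add_zero]
    -- `y ≠ 0` is the largest component below `x`
    have hsv : ∀ s, OnGrid s x → s ≤ v := fun s hs => OnGrid.le_of_odd hM (by rwa [hx] at hs)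
    have hwl : IsWeakExpansion (l' ++ [y]) := hw.sublist (List.sublist_append_left _ [x])
    have hexp : IsExpansion 1 (l' ++ [y]) := hwl.isExpansion
    have hwyx : WeakBelow y x :=
      (List.pairwise_append.mp hw.1).2.2 y (List.mem_append_right _ (List.mem_singleton_self y))
        x (List.mem_singleton_self x)
    have hzy : ∀ z ∈ l', Below 1 z y := fun z hz =>
      ((List.pairwise_append.mp hwl.1).2.2 z hz y (List.mem_singleton_self y)).below_one
    have htr : ∀ z ∈ l', NoDouble z y x := by
      intro z hz
      have h3 := (List.triplewise_append.mp hw.2).2.2.2 x (List.mem_singleton_self x)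
      exact (List.pairwise_append.mp h3).2.2 z hz y (List.mem_singleton_self y)
    have key : (∀ z ∈ l' ++ [y], |z| < (2 : ℚ) ^ (v - 1)) ∨
        (|y| = (2 : ℚ) ^ (v - 1) ∧ ∀ z ∈ l', |z| < (2 : ℚ) ^ (v - 2)) := by
      have hsmall : |y| < (2 : ℚ) ^ (v - 1) → ∀ z ∈ l' ++ [y], |z| < (2 : ℚ) ^ (v - 1) := by
        intro hy z hz
        rcases List.mem_append.mp hz with hz | hz
        · exact lt_trans ((hzy z hz).abs_lt le_rfl hy0) hy
        · rwa [List.mem_singleton.mp hz]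
      rcases hwyx with ⟨s, hs, hlt⟩ | ⟨⟨s, hs, hlt⟩, a, ha⟩
      · left
        have : (2 : ℚ) ^ s ≤ (2 : ℚ) ^ v := zpow_le_zpow_right₀ (by norm_num) (hsv s hs)
        exact hsmall (by rw [hv1]; linarith)
      · have hsv' : (2 : ℚ) ^ s ≤ (2 : ℚ) ^ v := zpow_le_zpow_right₀ (by norm_num) (hsv s hs)
        rw [one_mul] at hlt
        have hav : a ≤ v - 1 := by
          have : (2 : ℚ) ^ a < (2 : ℚ) ^ v := by rw [← ha]; linarith
          have := (zpow_lt_zpow_iff_right₀ (by norm_num : (1:ℚ) < 2)).mp this; omega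
        rcases lt_or_eq_of_le hav with hav | hav
        · left
          exact hsmall (by rw [ha]; exact zpow_lt_zpow_right₀ (by norm_num) hav)
        · right
          have hya : |y| = (2 : ℚ) ^ (v - 1) := by rw [ha, hav]
          refine ⟨hya, fun z hz => ?_⟩
          rcases htr z hz with ⟨s', hs'y, hlt'⟩ | ⟨s', hs'x, hlt'⟩
          · have hs'v : s' ≤ v - 1 := by
              have hg : OnGrid s' (((1 : ℤ) : ℚ) * (2 : ℚ) ^ (v - 1)) := by
                rw [Int.cast_one, one_mul, ← hya]; exact hs'y.abs
              exact OnGrid.le_of_odd (by decide) hg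
            have : (2 : ℚ) ^ s' ≤ (2 : ℚ) ^ (v - 1) := zpow_le_zpow_right₀ (by norm_num) hs'v
            rw [hv2]; rw [hv1] at this; linarith
          · exfalso
            have : (2 : ℚ) ^ s' ≤ (2 : ℚ) ^ v := zpow_le_zpow_right₀ (by norm_num) (hsv s' hs'x)
            rw [hya, hv1] at hlt'; linarith
    rcases key with hall | ⟨hya, hl'⟩
    · calc |(l' ++ [y]).sum| < (2 : ℚ) ^ (v - 1) := abs_sum_lt_two_zpow_of_isExpansion hlF hexp hall
        _ < 3 / 4 * (2 : ℚ) ^ v := by rw [hv1]; linarith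
    · have hexp' : IsExpansion 1 l' :=
        (hwl.sublist (List.sublist_append_left _ _)).isExpansion
      have hs' := abs_sum_lt_two_zpow_of_isExpansion hl'F hexp' hl'
      rw [List.sum_append, List.sum_singleton]
      calc |l'.sum + y| ≤ |l'.sum| + |y| := abs_add_le _ _
        _ < (2 : ℚ) ^ (v - 2) + (2 : ℚ) ^ (v - 1) := by linarith
        _ = 3 / 4 * (2 : ℚ) ^ v := by rw [hv1, hv2]; ring

/-- The tail bound in the form used below: for `x ≠ 0` a float with an odd-significand
representation supplied by `exists_odd_mul_two_zpow`. -/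
theorem abs_sum_lt_of_isWeakExpansion_append' {l : List ℚ} {x : ℚ}
    (hlF : ∀ y ∈ l, IsFloat p emin y) (hw : IsWeakExpansion (l ++ [x])) {M v : ℤ} (hM : Odd M)
    (hx : x = (M : ℚ) * (2 : ℚ) ^ v) : |l.sum| < 3 / 4 * (2 : ℚ) ^ v :=
  abs_sum_lt_of_isWeakExpansion_append l.length l x le_rfl hlF hw hM hx

/-! ### §3  The top component of a processed part with a large sum -/

/-- If a weakly nonoverlapping expansion of `p`-bit floats (`p ≥ 2`) with nonzero top component
`t`, `|t| ≤ (2^p − 1)·2^T`, sums to MORE than `(2^p − 1)·2^T` in magnitude, then its top component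
is `±(2^p − 1)·2^T` or `±(2^p − 2)·2^T` (by the tail bound, case by case on the position `2^w` of
the lowest nonzero bit of `t`). -/
theorem abs_top_of_isWeakExpansion (hp : 2 ≤ p) {l : List ℚ} {t : ℚ}
    (hlF : ∀ y ∈ l, IsFloat p emin y) (htF : IsFloat p emin t) (ht0 : t ≠ 0)
    (hw : IsWeakExpansion (l ++ [t])) {T : ℤ} (ht : |t| ≤ (2 ^ p - 1) * (2 : ℚ) ^ T)
    (hsum : (2 ^ p - 1) * (2 : ℚ) ^ T < |(l ++ [t]).sum|) :
    |t| = (2 ^ p - 1) * (2 : ℚ) ^ T ∨ |t| = (2 ^ p - 2) * (2 : ℚ) ^ T := by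
  have h2 : (0 : ℚ) < 2 := by norm_num
  have h2T : (0 : ℚ) < (2 : ℚ) ^ T := zpow_pos h2 _
  have hp1 : (2 : ℚ) ≤ 2 ^ (p - 1) := by
    calc (2 : ℚ) = 2 ^ 1 := by norm_num
      _ ≤ 2 ^ (p - 1) := pow_le_pow_right₀ (by norm_num) (by omega)
  have hpp : (2 : ℚ) ^ p = 2 * 2 ^ (p - 1) := by
    rw [← pow_succ']; congr 1; omega
  obtain ⟨M, w, hMo, hMp, -, hte⟩ := exists_odd_mul_two_zpow htF ht0
  have h2w : (0 : ℚ) < (2 : ℚ) ^ w := zpow_pos h2 _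
  have hM0 : M ≠ 0 := by rintro rfl; exact ht0 (by rw [hte]; simp)
  have hM1 : (1 : ℚ) ≤ |(M : ℚ)| := by rw [← Int.cast_abs]; exact_mod_cast Int.one_le_abs hM0
  have hMp' : |(M : ℚ)| < 2 ^ p := by rw [← Int.cast_abs]; exact_mod_cast hMp
  have htabs : |t| = |(M : ℚ)| * (2 : ℚ) ^ w := by rw [hte, abs_mul, abs_of_pos h2w]
  have htail : |l.sum| < 3 / 4 * (2 : ℚ) ^ w := abs_sum_lt_of_isWeakExpansion_append' hlF hw hMo hte
  have hS : |(l ++ [t]).sum| ≤ |l.sum| + |t| := by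
    rw [List.sum_append, List.sum_singleton]; exact abs_add_le _ _
  -- position of the lowest bit of `t` relative to `2^T`
  rcases lt_trichotomy w (T + 1) with hw | hw | hw
  · rcases lt_or_eq_of_le (show w ≤ T by omega) with hw | hw
    · -- `w ≤ T − 1`: `t` and the tail are tiny
      exfalso
      have hwT : (2 : ℚ) ^ w ≤ (2 : ℚ) ^ T / 2 := by
        have := zpow_le_zpow_right₀ (by norm_num : (1:ℚ) ≤ 2) (show w ≤ T - 1 by omega)
        rwa [zpow_sub_one₀ (by norm_num : (2:ℚ) ≠ 0), ← div_eq_mul_inv] at this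
      have htlt : |t| < 2 ^ p * (2 : ℚ) ^ w := by
        rw [htabs]; exact mul_lt_mul_of_pos_right hMp' h2w
      have : |(l ++ [t]).sum| < (3 / 4 + 2 ^ p) * ((2 : ℚ) ^ T / 2) := by
        calc |(l ++ [t]).sum| ≤ |l.sum| + |t| := hS
          _ < 3 / 4 * (2 : ℚ) ^ w + 2 ^ p * (2 : ℚ) ^ w := by linarith
          _ = (3 / 4 + 2 ^ p) * (2 : ℚ) ^ w := by ring
          _ ≤ (3 / 4 + 2 ^ p) * ((2 : ℚ) ^ T / 2) :=
            mul_le_mul_of_nonneg_left hwT (by positivity)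
      rw [hpp] at this hsum
      nlinarith
    · -- `w = T`: `|M| + 3/4 > 2^p − 1` forces `|M| = 2^p − 1`
      left
      subst hw
      have hlo : (2 : ℚ) ^ p - 1 - 3 / 4 < |(M : ℚ)| := by
        have : (2 ^ p - 1) * (2 : ℚ) ^ w < (|(M : ℚ)| + 3 / 4) * (2 : ℚ) ^ w := by
          calc (2 ^ p - 1) * (2 : ℚ) ^ w < |(l ++ [t]).sum| := hsum
            _ ≤ |l.sum| + |t| := hS
            _ < 3 / 4 * (2 : ℚ) ^ w + |(M : ℚ)| * (2 : ℚ) ^ w := by rw [← htabs]; linarith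
            _ = (|(M : ℚ)| + 3 / 4) * (2 : ℚ) ^ w := by ring
        have := lt_of_mul_lt_mul_right this h2w.le
        linarith
      have hhi : |(M : ℚ)| ≤ 2 ^ p - 1 := by
        rw [htabs] at ht
        exact le_of_mul_le_mul_right ht h2w
      have hMi : (2 : ℤ) ^ p - 1 ≤ |M| := by
        by_contra hc
        push Not at hc
        have h3 : |M| ≤ (2 : ℤ) ^ p - 2 := by have := Int.lt_iff_add_one_le.mp hc; linarith
        have h4 : ((|M| : ℤ) : ℚ) ≤ (((2 : ℤ) ^ p - 2 : ℤ) : ℚ) := by exact_mod_cast h3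
        push_cast at h4
        linarith
      have hMi' : ((((2 : ℤ) ^ p - 1 : ℤ)) : ℚ) ≤ ((|M| : ℤ) : ℚ) := by exact_mod_cast hMi
      push_cast at hMi'
      rw [htabs, le_antisymm hhi hMi']
  · -- `w = T + 1`: `2|M| + 3/2 > 2^p − 1` and `2|M| ≤ 2^p − 1` force `|M| = 2^(p−1) − 1`
    right
    subst hw
    have hTw : (2 : ℚ) ^ (T + 1) = 2 * (2 : ℚ) ^ T := by
      rw [zpow_add_one₀ (by norm_num : (2:ℚ) ≠ 0)]; ring
    have hlo : (2 : ℚ) ^ p - 1 - 3 / 2 < 2 * |(M : ℚ)| := by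
      have : (2 ^ p - 1) * (2 : ℚ) ^ T < (2 * |(M : ℚ)| + 3 / 2) * (2 : ℚ) ^ T := by
        calc (2 ^ p - 1) * (2 : ℚ) ^ T < |(l ++ [t]).sum| := hsum
          _ ≤ |l.sum| + |t| := hS
          _ < 3 / 4 * (2 : ℚ) ^ (T + 1) + |(M : ℚ)| * (2 : ℚ) ^ (T + 1) := by
            rw [← htabs]; linarith
          _ = (2 * |(M : ℚ)| + 3 / 2) * (2 : ℚ) ^ T := by rw [hTw]; ring
      have := lt_of_mul_lt_mul_right this h2T.le
      linarith
    have hhi : 2 * |(M : ℚ)| ≤ 2 ^ p - 1 := by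
      have h1 : |(M : ℚ)| * (2 : ℚ) ^ (T + 1) ≤ (2 ^ p - 1) * (2 : ℚ) ^ T := by rwa [htabs] at ht
      rw [hTw, show |(M : ℚ)| * (2 * (2 : ℚ) ^ T) = (2 * |(M : ℚ)|) * (2 : ℚ) ^ T by ring] at h1
      exact le_of_mul_le_mul_right h1 h2T
    -- integer bookkeeping with `K = 2^(p-1)`
    obtain ⟨K, hK⟩ : ∃ K : ℤ, (2 : ℤ) ^ p = 2 * K := ⟨2 ^ (p - 1), by
      rw [← pow_succ']; congr 1; omega⟩
    have hKq : (2 : ℚ) ^ p = 2 * (K : ℚ) := by exact_mod_cast hK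
    have h1 : 2 * |M| ≤ 2 * K - 1 := by
      have h3 : ((2 * |M| : ℤ) : ℚ) ≤ ((2 * K - 1 : ℤ) : ℚ) := by push_cast; linarith
      exact_mod_cast h3
    have h2' : 2 * K - 3 < 2 * |M| := by
      by_contra hc
      push Not at hc
      have h3 : ((2 * |M| : ℤ) : ℚ) ≤ ((2 * K - 3 : ℤ) : ℚ) := by exact_mod_cast hc
      push_cast at h3
      linarith
    have hMK : |M| = K - 1 := by omega
    have hMq : |(M : ℚ)| = (K : ℚ) - 1 := by rw [← Int.cast_abs, hMK]; push_cast; ring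
    rw [htabs, hMq, hTw, hKq]; ring
  · -- `w ≥ T + 2`: `|t| ≤ 2^(p+T) − 2^w` on the grid `2^w`, and the tail is `< 2^w`... too small
    exfalso
    have hwle : w ≤ p + T := by
      by_contra hc
      push Not at hc
      have h1 : (2 : ℚ) ^ (p + T) < (2 : ℚ) ^ w := zpow_lt_zpow_right₀ (by norm_num) hc
      have h2' : (2 : ℚ) ^ w ≤ |t| := by
        rw [htabs]; exact le_mul_of_one_le_left h2w.le hM1
      have h3 : |t| < (2 : ℚ) ^ (p + T) := by
        calc |t| ≤ (2 ^ p - 1) * (2 : ℚ) ^ T := ht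
          _ < 2 ^ p * (2 : ℚ) ^ T := by nlinarith
          _ = (2 : ℚ) ^ (p + T) := by rw [zpow_add₀ (by norm_num : (2:ℚ) ≠ 0), zpow_natCast]
      linarith
    have hgt : OnGrid w |t| := by rw [hte]; exact (show OnGrid w _ from ⟨M, rfl⟩).abs
    have hgP : OnGrid w ((2 : ℚ) ^ ((p : ℤ) + T)) := OnGrid.two_zpow hwle
    have htlt : |t| < (2 : ℚ) ^ ((p : ℤ) + T) := by
      calc |t| ≤ (2 ^ p - 1) * (2 : ℚ) ^ T := ht
        _ < 2 ^ p * (2 : ℚ) ^ T := by nlinarith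
        _ = (2 : ℚ) ^ ((p : ℤ) + T) := by rw [zpow_add₀ (by norm_num : (2:ℚ) ≠ 0), zpow_natCast]
    have hle : |t| + (2 : ℚ) ^ w ≤ (2 : ℚ) ^ ((p : ℤ) + T) := hgt.add_two_zpow_le hgP htlt
    have hwT : (2 : ℚ) ^ T ≤ (2 : ℚ) ^ w / 4 := by
      have := zpow_le_zpow_right₀ (by norm_num : (1:ℚ) ≤ 2) (show T ≤ w - 2 by omega)
      rw [show w - 2 = w - 1 - 1 by ring, zpow_sub_one₀ (by norm_num : (2:ℚ) ≠ 0),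
        zpow_sub_one₀ (by norm_num : (2:ℚ) ≠ 0)] at this
      linarith
    have hPT : (2 : ℚ) ^ ((p : ℤ) + T) = 2 ^ p * (2 : ℚ) ^ T := by
      rw [zpow_add₀ (by norm_num : (2:ℚ) ≠ 0), zpow_natCast]
    have : |(l ++ [t]).sum| < (2 : ℚ) ^ ((p : ℤ) + T) - (2 : ℚ) ^ w / 4 := by
      calc |(l ++ [t]).sum| ≤ |l.sum| + |t| := hS
        _ < 3 / 4 * (2 : ℚ) ^ w + ((2 : ℚ) ^ ((p : ℤ) + T) - (2 : ℚ) ^ w) := by linarith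
        _ = (2 : ℚ) ^ ((p : ℤ) + T) - (2 : ℚ) ^ w / 4 := by ring
    rw [hPT] at this
    nlinarith

/-! ### §4  A loop step from the strengthened invariant `FesInvW` (part 1): the opening moves

What holds right after `(Q', h) := TWO-SUM(Q, z)` with `h ≠ 0`, `T = ⌊log₂|h|⌋`, from the plain
invariant `FesInv` alone (sizes of `h`, grids, `|Q + z| ≥ (2^p + 1)·2^T` by Corollary 8(a), and the
processed inputs sum to `> 2^(T+p)`). -/

/-- The facts about ONE `TWO-SUM` step `(Q', h) := TWO-SUM(Q, z)` with a NONZERO roundoff `h`,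
`T := ⌊log₂|h|⌋`, that every later argument uses: `z ≠ 0`; `h = Q + z − Q'`, `Q' = fl(Q + z)`; the
old grid `2^g` contains `Q + z`, `Q'`, `h`, and `g ≤ T`, `emin ≤ T`; the earlier outputs sum to
`< 2^g`; Corollary 8(a) `|Q + z| ≥ 2^T(2^p + 1)`; hence the processed inputs sum to `> 2^(T+p)`. -/
theorem FesInvW.prelude (hp : 1 ≤ p) (hfl : IsRoundNearest p emin fl)
    {e f e₁ f₁ e₂' f₂ : List ℚ} {z Q : ℚ} {hs : List ℚ} {g : ℤ}
    (heF : ∀ x ∈ e, IsFloat p emin x) (hI : FesInv p emin e f e₁ f₁ (z :: e₂') f₂ Q hs g)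
    {Q' h : ℚ} (hQ' : (twoSum fl Q z).1 = Q') (hh : (twoSum fl Q z).2 = h) (hh0 : h ≠ 0)
    {T : ℤ} (hT : Int.log 2 |h| = T) :
    z ≠ 0 ∧ h = Q + z - Q' ∧ Q' = fl (Q + z) ∧ OnGrid g (Q + z) ∧ OnGrid g Q' ∧ OnGrid g h ∧
      (2 : ℚ) ^ T ≤ |h| ∧ |h| < (2 : ℚ) ^ (T + 1) ∧ g ≤ T ∧ emin ≤ T ∧ |hs.sum| < (2 : ℚ) ^ g ∧
      (2 : ℚ) ^ T * (2 ^ p + 1) ≤ |Q + z| ∧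
      (2 : ℚ) ^ (T + p) < |(e₁ ++ [z]).sum + f₁.sum| := by
  have hze : z ∈ e := by rw [hI.he]; exact List.mem_append_right _ List.mem_cons_self
  have hzF : IsFloat p emin z := heF z hze
  obtain ⟨hh_eq, hQh⟩ := twoSum_exact hp hfl hI.hQ hzF
  rw [hh] at hh_eq
  have hQ'eq : Q' = fl (Q + z) := by rw [← hQ']; exact Literature.ComputerArithmetic.Shewchuk1997.twoSum_fst fl Q z
  have hh_eq' : h = Q + z - Q' := by rw [hQ'eq]; exact hh_eq
  have hz0 : z ≠ 0 := by
    rintro rfl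
    apply hh0
    rw [hh_eq, add_zero, fl_eq_self hfl hI.hQ, sub_self]
  have hQzg : OnGrid g (Q + z) := hI.hQg.add (hI.hrg z (List.mem_append_left _ List.mem_cons_self))
  have hQ'g : OnGrid g Q' := by rw [hQ'eq]; exact hQzg.fl_of hp hfl hI.hg
  have hhg : OnGrid g h := by rw [hh_eq']; exact hQzg.sub hQ'g
  have hTh : (2 : ℚ) ^ T ≤ |h| := hT ▸ zpow_log_le_abs hh0
  have hhT : |h| < (2 : ℚ) ^ (T + 1) := hT ▸ abs_lt_zpow_log_succ h
  have hgT : g ≤ T := by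
    have : (2 : ℚ) ^ g < (2 : ℚ) ^ (T + 1) := lt_of_le_of_lt (hhg.two_zpow_le_abs hh0) hhT
    have := (zpow_lt_zpow_iff_right₀ (by norm_num : (1:ℚ) < 2)).mp this; omega
  have hS : |hs.sum| < (2 : ℚ) ^ g := abs_sum_lt_two_zpow_of_isExpansion hI.hhs hI.hexp hI.hhg
  have hC := le_abs_add_of_two_zpow_le_abs_err hp hfl hI.hQ hzF (i := T)
    (by rw [← hh_eq]; exact hTh)
  have hQz : Q + z = ((e₁ ++ [z]).sum + f₁.sum) - hs.sum := by
    have := hI.hsum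
    rw [List.sum_append, List.sum_singleton]; linear_combination this
  have hTp : (2 : ℚ) ^ T * (2 ^ p + 1) = (2 : ℚ) ^ (T + p) + (2 : ℚ) ^ T := by
    rw [zpow_add₀ (by norm_num : (2:ℚ) ≠ 0), zpow_natCast]; ring
  have hbig : (2 : ℚ) ^ (T + p) < |(e₁ ++ [z]).sum + f₁.sum| := by
    have hC' := hC
    rw [hQz, hTp] at hC'
    have htri : |((e₁ ++ [z]).sum + f₁.sum) - hs.sum| ≤ |(e₁ ++ [z]).sum + f₁.sum| + |hs.sum| :=
      abs_sub _ _
    have hgT' : (2 : ℚ) ^ g ≤ (2 : ℚ) ^ T := zpow_le_zpow_right₀ (by norm_num) hgT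
    linarith
  exact ⟨hz0, hh_eq', hQ'eq, hQzg, hQ'g, hhg, hTh, hhT, hgT, by have := hI.hg; omega, hS, hC, hbig⟩

end Summit.Ventures.CertifiedArithmetic.Expansions
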